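import Literature.Barriers.MatrixMultiplication.RectangularBarrierOmegaTwoPrelim
import Summits.MatrixMultiplication.MatrixMultiplication.Theses.SaturationLadder
import HarnessLib

/-!
# The `CW_q`-method floor under the defect ladder is positive UNIFORMLY in the grade and in `q`:
# no `CW_q`-method certifies `ω(1,p,1) = p + 1` at any `p ≥ 1` (route `SaturationLadder`, item
# stmt-MatrixMultiplication-29474 `TailDescentTwo`; cell `decomp-mm`, lens 1 «grading / quantitative
# ladder», gen 22, part E — the symbolic companion of the certified rows of part D,
# `…Theorems.SaturationLadderDefectFloor{,Far,Wide,Near,Mid,FixedQ,Seven,Twelve,TwoHundred}`)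

PROVED, 0 sorry, no definitions, no named facts.  Part D priced the `CW_q`-METHOD FLOOR under the defect
`δ_k = ω(1,k,1) − (k+1)` by 23 certified `ζ^θ`-barrier rows `k + 1 + β_q(k) ≤ ω̂` at fixed grades
`(k, q)`.  This file proves the qualitative statement behind every row AT ONCE, for all `q : ℕ` and all
real `p ≥ 1`, by an explicit one-parameter family of dual certificates:

* `add_one_lt_of_tMethodBound_bigCw`: `IsTMethodBound K (bigCwTensor K q) p ω̂ → p + 1 < ω̂` — every
  upper bound on `ω(p)` obtained from a power of `CW_q` by restriction (Schönhage's `τ`-method, the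
  tree's `IsTMethodBound`) is STRICTLY above the lower bound `p + 1`; equivalently no `CW_q`-method
  proves `ω(1,p,1) = p + 1` — the onset hypothesis of `TailDescentTwo` / `FiniteSaturation` — at any
  grade, for any `q` (`nat_add_one_lt_of_tMethodBound_bigCw`, `omegaRect_lt_tMethodBound_of_eq_add_one`:
  at a zero of the defect the true value `ω(1,k,1)` lies strictly below every `CW_q`-method bound).

*The certificate* (all logarithms natural; `L = ln(q+2)`, `ρ = L/(p+1)`): weights
`θ = ((1−σ)/2, σ, (1−σ)/2)`; first and third marginal laws `Q₁ = Q₃ = ((1+δ)/(q+2), 1/(q+2) (×q),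
(1−δ)/(q+2))` (corner weight tilted UP, far weight tilted DOWN); middle law `Q₂ = (a, b (×q), b)` with
`a = e^{−ρ}`, `b = (1−a)/(q+1)`; constants `M = −ln b + 2L + 1`, `σ = min(¼, L/(256(p+1)M²))`, `δ = 8σM`
(so `δ ≤ 1/128`).  With `H = L − σpρ + σρ/2` the six support costs of `CW_q` (types `A`–`F` of
`RectangularBarrierCwChain`) are `≤ H` (`arith_cost_A/B/D/E`; `C = A`, `F = D`), using only
`ln(1+δ) ≥ δ − δ²`, `−ln(1−δ) ≤ δ + 2δ²`, `3δ² ≤ σρ` and `σM ≤ (1−σ)(δ−δ²)/2`; `0 < H ≤ L`; and the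
Christandl–Le Gall–Lysikov–Zuiddam bound `omegaHat_bigCw_ge_of_costs` gives
`ω̂ ≥ (L/H)·((1+σ) + p(1−σ)) > p + 1` because `(p+1)H = (p+1)L − σpL + σL/2 < (p+1)L − σ(p−1)L`
(`arith_final`).  At `σ = 0` (`θ = (½,0,½)`, uniform `Q₁ = Q₃`) the same computation returns exactly
`p + 1` — the floor is positive only through the second-order tilt, which is why it is small
(`≈ 0.06/ln k` along the `q` of record, `≈ 0.3/(k ln k)` at fixed `q`, part D).

*Reading for the node.*  `TailDescentTwo : (∃ k ≥ 3, ω(1,k,1) = k+1) → ω(1,2,1) = 3` asks to propagate a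
ZERO of the defect downward.  This file shows, in proved currency and uniformly, that such a zero is
invisible to the whole `CW_q`-method family (every `q`, every grade `k ≥ 1`): a proof of the node's
hypothesis, or of its conclusion `ω(1,2,1) = 3`, needs an intermediate tensor outside `{CW_q^{⊗N}}`
or a reduction outside restriction-from-powers (BC9: the method family's ceiling is a theorem, not a
table).  It does not bound `ω(1,k,1)` itself.

*Print scope.*  Christandl–Le Gall–Lysikov–Zuiddam compute the `CW_q` barrier numerically for
`p ∈ [0, 2]` (Fig. 1, `q = 6`), for `α` (Fig. 2, `q ≤ 8`; the uniform `α ≤ 0.625` is the tree's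
`RectangularBarrierAlphaCW`) and for `ω(2)` (Table 1), and note that the barrier applies for `p ≥ 1`
(§1.3.1); a closed-form certificate valid for all `p ≥ 1` and all `q` is not tabulated there.

References: Christandl–Le Gall–Lysikov–Zuiddam, *Barriers for rectangular matrix multiplication*, comput.
complexity 34 (2025) = arXiv:2003.03019, Thm. 3.15, eq. (5), §1.3.1, §4.4 [ChristandlLeGallLysikovZuiddam2025];
Christandl–Vrana–Zuiddam, *Universal points in the asymptotic spectrum of tensors*, JAMS 36 (2023), §4
(support functionals on free tensors) [ChristandlVranaZuiddam2023]; Coppersmith, *Rectangular matrix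
multiplication revisited*, J. Complexity 13 (1997) [Coppersmith1997].
-/

set_option linter.dupNamespace false

noncomputable section

namespace Summit.MatrixMultiplication.MatrixMultiplication.Theorems.SaturationLadderDefectFloorUniform

open Literature.Barriers.MatrixMultiplication Literature.Computability.AlgebraicComplexity

/-- From a cost inequality in nats to the tree's form in bits. [folklore] -/
theorem cost_div_log_two {w₀ w₁ X Y Z H : ℝ}
    (h : w₀ * (-Real.log X) + w₁ * (-Real.log Y) + w₀ * (-Real.log Z) ≤ H) :
    w₀ * (-Real.log X / Real.log 2) + w₁ * (-Real.log Y / Real.log 2) +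
      w₀ * (-Real.log Z / Real.log 2) ≤ H / Real.log 2 := by
  have hl : 0 < Real.log 2 := Real.log_pos one_lt_two
  have e : w₀ * (-Real.log X / Real.log 2) + w₁ * (-Real.log Y / Real.log 2) +
      w₀ * (-Real.log Z / Real.log 2)
      = (w₀ * (-Real.log X) + w₁ * (-Real.log Y) + w₀ * (-Real.log Z)) / Real.log 2 := by ring
  rw [e]
  exact div_le_div_of_nonneg_right h hl.le

/-- `log (1 + δ) ≥ δ − δ²` for `δ ≥ 0`. [folklore] -/
theorem sub_sq_le_log_one_add {δ : ℝ} (hδ : 0 ≤ δ) : δ - δ ^ 2 ≤ Real.log (1 + δ) := by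
  have h1 : 0 < 1 + δ := by linarith [hδ]
  have h := Real.one_sub_inv_le_log_of_pos h1
  have e : 1 - (1 + δ)⁻¹ = δ / (1 + δ) := by field_simp; ring
  rw [e] at h
  have h2 : δ - δ ^ 2 ≤ δ / (1 + δ) := by
    rw [le_div_iff₀ h1]; nlinarith [sq_nonneg δ, mul_nonneg hδ (sq_nonneg δ)]
  exact h2.trans h

/-- `−log (1 − δ) ≤ δ + 2δ²` for `δ ≤ ½`. [folklore] -/
theorem neg_log_one_sub_le {δ : ℝ} (hδ2 : δ ≤ 1 / 2) :
    -Real.log (1 - δ) ≤ δ + 2 * δ ^ 2 := by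
  have h1 : 0 < 1 - δ := by linarith
  have h := Real.one_sub_inv_le_log_of_pos h1
  have e : 1 - (1 - δ)⁻¹ = -(δ / (1 - δ)) := by field_simp; ring
  rw [e] at h
  have h2 : δ / (1 - δ) ≤ δ + 2 * δ ^ 2 := by
    rw [div_le_iff₀ h1]
    have : 0 ≤ δ ^ 2 * (1 - 2 * δ) := mul_nonneg (sq_nonneg δ) (by linarith)
    nlinarith [this]
  linarith

/-! ## Arithmetic of the certificate (small contexts) -/

/-- `δ = 8σM ≤ 1/128` from `σ·256(p+1)M² ≤ L ≤ M/2`, `p ≥ 1`. [folklore] -/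
theorem arith_delta_small {σ M L p : ℝ} (hσ0 : 0 < σ) (hM0 : 0 < M) (hML : 2 * L ≤ M) (hp : 1 ≤ p)
    (hσM : σ * (256 * (p + 1) * M ^ 2) ≤ L) : 8 * σ * M ≤ 1 / 128 := by
  have h1 : σ * (512 * M ^ 2) ≤ σ * (256 * (p + 1) * M ^ 2) := by
    apply mul_le_mul_of_nonneg_left _ hσ0.le
    have : 0 ≤ 256 * M ^ 2 * (p - 1) := mul_nonneg (by positivity) (by linarith)
    nlinarith [this]
  have h2 : σ * (512 * M ^ 2) ≤ M / 2 := by linarith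
  have h3 : (σ * M * 1024) * M ≤ 1 * M := by
    have e : (σ * M * 1024) * M = 2 * (σ * (512 * M ^ 2)) := by ring
    rw [e]; linarith
  have h4 : σ * M * 1024 ≤ 1 := le_of_mul_le_mul_right h3 hM0
  linarith

/-- `σM ≤ (1−σ)(δ−δ²)/2` for `δ = 8σM ≤ 1/128`, `σ ≤ ¼`. [folklore] -/
theorem arith_sigma_M {σ M δ : ℝ} (hσ0 : 0 < σ) (hM0 : 0 < M) (hσ4 : σ ≤ 1 / 4)
    (hδ : δ = 8 * σ * M) (hδs : δ ≤ 1 / 128) : σ * M ≤ (1 - σ) * (δ - δ ^ 2) / 2 := by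
  have hδ0 : 0 < δ := by rw [hδ]; positivity
  have hA : (3 : ℝ) / 4 ≤ 1 - σ := by linarith
  have hB : (127 : ℝ) / 128 ≤ 1 - δ := by linarith
  have h1 : (3 : ℝ) / 4 * (δ * ((127 : ℝ) / 128)) ≤ (1 - σ) * (δ * (1 - δ)) :=
    mul_le_mul hA (mul_le_mul_of_nonneg_left hB hδ0.le) (by positivity) (by linarith)
  have e : (1 - σ) * (δ - δ ^ 2) / 2 = (1 - σ) * (δ * (1 - δ)) / 2 := by ring
  rw [e]
  have h2 : σ * M = δ / 8 := by rw [hδ]; ring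
  rw [h2]
  linarith

/-- `3δ² ≤ σρ` for `δ = 8σM`, `σ·256(p+1)M² ≤ ρ(p+1)`. [folklore] -/
theorem arith_delta_sq {σ M δ ρ p : ℝ} (hσ0 : 0 < σ) (hp1 : 0 < p + 1) (hδ : δ = 8 * σ * M)
    (hσM : σ * (256 * (p + 1) * M ^ 2) ≤ ρ * (p + 1)) : 3 * δ ^ 2 ≤ σ * ρ := by
  have h1 : σ * (256 * M ^ 2) * (p + 1) ≤ ρ * (p + 1) := by
    have e : σ * (256 * M ^ 2) * (p + 1) = σ * (256 * (p + 1) * M ^ 2) := by ring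
    rw [e]; exact hσM
  have h2 : σ * (256 * M ^ 2) ≤ ρ := le_of_mul_le_mul_right h1 hp1
  have h3 : 192 * σ * M ^ 2 ≤ ρ := by
    have : 0 ≤ σ * M ^ 2 := by positivity
    linarith
  have e3 : 3 * δ ^ 2 = σ * (192 * σ * M ^ 2) := by rw [hδ]; ring
  rw [e3]
  exact mul_le_mul_of_nonneg_left h3 hσ0.le

/-- Cost of the `B`-type points `(i, 0, i)`. [folklore] -/
theorem arith_cost_B {L σ p ρ : ℝ} (hσ0 : 0 ≤ σ) (hρ0 : 0 < ρ) (hρL : ρ * (p + 1) = L) :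
    (1 - σ) / 2 * L + σ * ρ + (1 - σ) / 2 * L ≤ L - σ * (p * ρ) + σ * ρ / 2 := by
  have e : p * ρ = L - ρ := by linear_combination hρL
  rw [e]
  have h : σ * (ρ / 2) ≤ σ * ρ := mul_le_mul_of_nonneg_left (by linarith) hσ0
  nlinarith [h]

/-- Cost of the `D`/`F`-type corner points. [folklore] -/
theorem arith_cost_D {L σ p ρ δ l₁ l₂ : ℝ} (hσ0 : 0 ≤ σ) (hσ1 : σ ≤ 1) (hρL : ρ * (p + 1) = L)
    (hl1 : δ - δ ^ 2 ≤ l₁) (hl2 : l₂ ≤ δ + 2 * δ ^ 2) (hδsq : 3 * δ ^ 2 ≤ σ * ρ) :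
    (1 - σ) / 2 * (L - l₁) + σ * ρ + (1 - σ) / 2 * (L + l₂) ≤ L - σ * (p * ρ) + σ * ρ / 2 := by
  have e : p * ρ = L - ρ := by linear_combination hρL
  rw [e]
  have hsum : (L - l₁) + (L + l₂) ≤ 2 * L + 3 * δ ^ 2 := by linarith
  have hw : 0 ≤ (1 - σ) / 2 := by linarith
  have h1 : (1 - σ) / 2 * ((L - l₁) + (L + l₂)) ≤ (1 - σ) / 2 * (2 * L + 3 * δ ^ 2) :=
    mul_le_mul_of_nonneg_left hsum hw
  have h2 : (1 - σ) / 2 * (3 * δ ^ 2) ≤ 1 / 2 * (σ * ρ) := by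
    have : (1 - σ) / 2 ≤ 1 / 2 := by linarith
    have h3 : 0 ≤ 3 * δ ^ 2 := by positivity
    calc (1 - σ) / 2 * (3 * δ ^ 2) ≤ 1 / 2 * (3 * δ ^ 2) := mul_le_mul_of_nonneg_right this h3
      _ ≤ 1 / 2 * (σ * ρ) := by linarith
  nlinarith [h1, h2]

/-- Cost of the `E`-type corner point `(0, q+1, 0)`. [folklore] -/
theorem arith_cost_E {L σ p ρ δ l₁ Λ M : ℝ} (hσ0 : 0 ≤ σ) (hσ1 : σ ≤ 1) (hρ0 : 0 ≤ ρ)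
    (hM0 : 0 ≤ M) (hρL : ρ * (p + 1) = L) (hl1 : δ - δ ^ 2 ≤ l₁) (hΛM : Λ ≤ M)
    (hσM : σ * M ≤ (1 - σ) * (δ - δ ^ 2) / 2) :
    (1 - σ) / 2 * (L - l₁) + σ * Λ + (1 - σ) / 2 * (L - l₁) ≤ L - σ * (p * ρ) + σ * ρ / 2 := by
  have e : p * ρ = L - ρ := by linear_combination hρL
  rw [e]
  have h1 : σ * Λ ≤ σ * M := mul_le_mul_of_nonneg_left hΛM hσ0
  have h2 : (1 - σ) * (δ - δ ^ 2) ≤ (1 - σ) * l₁ := mul_le_mul_of_nonneg_left hl1 (by linarith)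
  have h4 : 0 ≤ σ * ρ := mul_nonneg hσ0 hρ0
  have h5 : 0 ≤ σ * M := mul_nonneg hσ0 hM0
  have h6 : σ * Λ - (1 - σ) * l₁ ≤ 0 := by nlinarith [h1, h2, h5, hσM]
  nlinarith [h6, h4]

/-- Cost of the `A`/`C`-type points `(0, i, i)`, `(i, i, 0)`. [folklore] -/
theorem arith_cost_A {L σ p ρ δ l₁ Λ M : ℝ} (hσ0 : 0 ≤ σ) (hσ1 : σ ≤ 1) (hρ0 : 0 ≤ ρ)
    (hρL : ρ * (p + 1) = L) (hl1 : δ - δ ^ 2 ≤ l₁) (hΛM : Λ ≤ M)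
    (hσM : σ * M ≤ (1 - σ) * (δ - δ ^ 2) / 2) :
    (1 - σ) / 2 * (L - l₁) + σ * Λ + (1 - σ) / 2 * L ≤ L - σ * (p * ρ) + σ * ρ / 2 := by
  have e : p * ρ = L - ρ := by linear_combination hρL
  rw [e]
  have h1 : σ * Λ ≤ σ * M := mul_le_mul_of_nonneg_left hΛM hσ0
  have h2 : (1 - σ) * (δ - δ ^ 2) ≤ (1 - σ) * l₁ := mul_le_mul_of_nonneg_left hl1 (by linarith)
  have h4 : 0 ≤ σ * ρ := mul_nonneg hσ0 hρ0
  nlinarith [h1, h2, h4, hσM]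

/-- The final comparison `(p+1)·H < L·((1+σ) + p(1−σ))`. [folklore] -/
theorem arith_final {L σ p ρ : ℝ} (hσ0 : 0 < σ) (hL0 : 0 < L) (hρL : ρ * (p + 1) = L) :
    (p + 1) * (L - σ * (p * ρ) + σ * ρ / 2) < L * ((1 + σ) + p * (1 - σ)) := by
  have h3 : σ * (p * ρ) * (p + 1) = σ * p * L := by rw [← hρL]; ring
  have h4 : σ * ρ / 2 * (p + 1) = σ * L / 2 := by rw [← hρL]; ring
  have h5 : 0 < σ * L := mul_pos hσ0 hL0
  nlinarith [h3, h4, h5]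

/-- `0 < H ≤ L`. [folklore] -/
theorem arith_H_bounds {L σ p ρ : ℝ} (hσ0 : 0 < σ) (hσ4 : σ ≤ 1 / 4) (hL0 : 0 < L) (hρ0 : 0 < ρ)
    (hp : 1 ≤ p) (hρL : ρ * (p + 1) = L) :
    0 < L - σ * (p * ρ) + σ * ρ / 2 ∧ L - σ * (p * ρ) + σ * ρ / 2 ≤ L := by
  have e : p * ρ = L - ρ := by linear_combination hρL
  rw [e]
  have h1 : σ * (L - ρ) ≤ σ * L := mul_le_mul_of_nonneg_left (by linarith) hσ0.le
  have h2 : 0 ≤ σ * ρ := by positivity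
  have h3 : σ * L ≤ 1 / 4 * L := mul_le_mul_of_nonneg_right hσ4 hL0.le
  have h4 : ρ * 2 ≤ ρ * (p + 1) := mul_le_mul_of_nonneg_left (by linarith) hρ0.le
  constructor
  · nlinarith [h1, h2, h3]
  · nlinarith [h4, hρL, h2, mul_pos hσ0 hρ0]

/-- **Uniform strict positivity of the `CW_q`-method floor.**  For every field `K`, every `q` and
every real `p ≥ 1`, every `CW_q`-method bound `ω̂` on `ω(p)` satisfies `p + 1 < ω̂`: no `CW_q`-method
(restriction form, `IsTMethodBound`) certifies the lower-bound value `ω(1,p,1) = p + 1` at any grade —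
in particular the hypothesis of `TailDescentTwo` (a zero of the defect `δ_k`) is out of reach of every
`CW_q`-method, uniformly in `k` and `q`.  Proof: the Christandl–Le Gall–Lysikov–Zuiddam `ζ^θ`-barrier
(`omegaHat_bigCw_ge_of_costs`) with the explicit dual certificate `θ = ((1−σ)/2, σ, (1−σ)/2)`,
`Q₁ = Q₃ = ((1+δ)/(q+2), 1/(q+2) ×q, (1−δ)/(q+2))`, `Q₂ = (a, (1−a)/(q+1) ×(q+1))`, `a = e^{−ρ}`,
`ρ = L/(p+1)`, `L = ln(q+2)`, `δ = 8σM`, `M = −ln((1−a)/(q+1)) + 2L + 1`, `σ = min(¼, L/(256(p+1)M²))`,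
all of whose costs are `≤ H = L − σpρ + σρ/2`, while `(p+1)H < L((p+1) − (p−1)σ)`.
[cite: ChristandlLeGallLysikovZuiddam2025, Thm. 3.15 with eq. (5)] -/
theorem add_one_lt_of_tMethodBound_bigCw (K : Type) [Field K] (q : ℕ) {p ω : ℝ} (hp : 1 ≤ p)
    (hω : IsTMethodBound K (bigCwTensor K q) p ω) : p + 1 < ω := by
  -- the base logarithm
  have hq0 : (0 : ℝ) ≤ (q : ℝ) := Nat.cast_nonneg q
  have hQ1 : (1 : ℝ) < (q : ℝ) + 2 := by linarith
  have hQ0 : (0 : ℝ) < (q : ℝ) + 2 := by linarith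
  set L : ℝ := Real.log ((q : ℝ) + 2) with hLdef
  have hL0 : 0 < L := Real.log_pos hQ1
  have hp1 : (0 : ℝ) < p + 1 := by linarith
  -- ρ = L/(p+1); the second-factor corner weight a = e^{-ρ} and middle/far weight b
  set ρ : ℝ := L / (p + 1) with hρdef
  have hρ0 : 0 < ρ := div_pos hL0 hp1
  have hρL : ρ * (p + 1) = L := by rw [hρdef]; field_simp
  set a : ℝ := Real.exp (-ρ) with hadef
  have ha0 : 0 < a := Real.exp_pos _
  have ha1 : a < 1 := by
    have : Real.exp (-ρ) < Real.exp 0 := Real.exp_lt_exp.mpr (by linarith)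
    simpa [hadef] using this
  have hla : -Real.log a = ρ := by rw [hadef, Real.log_exp]; ring
  have hq1 : (0 : ℝ) < (q : ℝ) + 1 := by linarith
  set b : ℝ := (1 - a) / ((q : ℝ) + 1) with hbdef
  have hb0 : 0 < b := div_pos (by linarith) hq1
  have hb1 : b < 1 := by
    rw [hbdef, div_lt_one hq1]; linarith
  have hΛ0 : 0 < -Real.log b := by
    have := Real.log_neg hb0 hb1; linarith
  -- the constant `M` and the small parameters `σ`, `δ`
  set M : ℝ := -Real.log b + 2 * L + 1 with hMdef
  have hM0 : 0 < M := by linarith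
  have hMΛ : -Real.log b ≤ M := by linarith
  have hML : 2 * L ≤ M := by linarith
  set σ : ℝ := min (1 / 4) (L / (256 * (p + 1) * M ^ 2)) with hσdef
  have hden : (0 : ℝ) < 256 * (p + 1) * M ^ 2 := by positivity
  have hσ0 : 0 < σ := lt_min (by norm_num) (div_pos hL0 hden)
  have hσ4 : σ ≤ 1 / 4 := min_le_left _ _
  have hσ1 : σ ≤ 1 := by linarith
  have hσM : σ * (256 * (p + 1) * M ^ 2) ≤ L := by
    have h := min_le_right (1 / 4 : ℝ) (L / (256 * (p + 1) * M ^ 2))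
    rwa [← hσdef, le_div_iff₀ hden] at h
  have hσM' : σ * (256 * (p + 1) * M ^ 2) ≤ ρ * (p + 1) := by rw [hρL]; exact hσM
  set δ : ℝ := 8 * σ * M with hδdef
  have hδ0 : 0 < δ := by positivity
  have hδs : δ ≤ 1 / 128 := arith_delta_small hσ0 hM0 hML hp hσM
  have hδ1 : δ < 1 := by linarith
  have hσMδ : σ * M ≤ (1 - σ) * (δ - δ ^ 2) / 2 := arith_sigma_M hσ0 hM0 hσ4 hδdef hδs
  have hδsq : 3 * δ ^ 2 ≤ σ * ρ := arith_delta_sq hσ0 hp1 hδdef hσM'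
  -- first/third-factor levels
  set α : ℝ := (1 + δ) / ((q : ℝ) + 2) with hαdef
  set β : ℝ := 1 / ((q : ℝ) + 2) with hβdef
  set γ : ℝ := (1 - δ) / ((q : ℝ) + 2) with hγdef
  have hα0 : 0 < α := div_pos (by linarith) hQ0
  have hβ0 : 0 < β := div_pos one_pos hQ0
  have hγ0 : 0 < γ := div_pos (by linarith) hQ0
  have hmass₁ : α + (q : ℝ) * β + γ ≤ 1 := by
    have e : α + (q : ℝ) * β + γ = 1 := by
      rw [hαdef, hβdef, hγdef]; field_simp; ring
    exact e.le
  have hmass₂ : a + (q : ℝ) * b + b ≤ 1 := by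
    have e : a + (q : ℝ) * b + b = 1 := by
      rw [hbdef]; field_simp; ring
    exact e.le
  -- closed forms and bounds of the logarithms
  have hlβ : -Real.log β = L := by
    rw [hβdef, one_div, Real.log_inv, neg_neg]
  have hlα : -Real.log α = L - Real.log (1 + δ) := by
    rw [hαdef, Real.log_div (by linarith) hQ0.ne']; ring
  have hlγ : -Real.log γ = L + (-Real.log (1 - δ)) := by
    rw [hγdef, Real.log_div (by linarith) hQ0.ne']; ring
  have hl1 : δ - δ ^ 2 ≤ Real.log (1 + δ) := sub_sq_le_log_one_add hδ0.le
  have hl2 : -Real.log (1 - δ) ≤ δ + 2 * δ ^ 2 := neg_log_one_sub_le (by linarith)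
  -- the weights
  set τ : ℝ := (1 - σ) / 2 with hτdef
  have hτ0 : 0 ≤ τ := by rw [hτdef]; linarith
  have hτ1 : 2 * τ ≤ 1 := by rw [hτdef]; linarith
  have hmid : 1 - 2 * τ = σ := by rw [hτdef]; ring
  -- the entropy bound `H` (nats)
  set H : ℝ := L - σ * (p * ρ) + σ * ρ / 2 with hHdef
  have hHb := arith_H_bounds hσ0 hσ4 hL0 hρ0 hp hρL
  have hH0 : 0 < H := hHb.1
  have hHL : H ≤ L := hHb.2
  have hl2pos : 0 < Real.log 2 := Real.log_pos one_lt_two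
  have hh0 : 0 < H / Real.log 2 := div_pos hH0 hl2pos
  have hhL : H / Real.log 2 ≤ Real.logb 2 ((q : ℝ) + 2) := by
    rw [Real.logb]; exact div_le_div_of_nonneg_right hHL hl2pos.le
  -- the six cost inequalities (nats)
  have cA : τ * (-Real.log α) + (1 - 2 * τ) * (-Real.log b) + τ * (-Real.log β) ≤ H := by
    rw [hlα, hlβ, hmid, hτdef, hHdef]
    exact arith_cost_A hσ0.le hσ1 hρ0.le hρL hl1 hMΛ hσMδ
  have cB : τ * (-Real.log β) + (1 - 2 * τ) * (-Real.log a) + τ * (-Real.log β) ≤ H := by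
    rw [hlβ, hla, hmid, hτdef, hHdef]
    exact arith_cost_B hσ0.le hρ0 hρL
  have cC : τ * (-Real.log β) + (1 - 2 * τ) * (-Real.log b) + τ * (-Real.log α) ≤ H := by
    linarith [cA]
  have cD : τ * (-Real.log α) + (1 - 2 * τ) * (-Real.log a) + τ * (-Real.log γ) ≤ H := by
    rw [hlα, hla, hlγ, hmid, hτdef, hHdef]
    exact arith_cost_D hσ0.le hσ1 hρL hl1 hl2 hδsq
  have cE : τ * (-Real.log α) + (1 - 2 * τ) * (-Real.log b) + τ * (-Real.log α) ≤ H := by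
    rw [hlα, hmid, hτdef, hHdef]
    exact arith_cost_E hσ0.le hσ1 hρ0.le hM0.le hρL hl1 hMΛ hσMδ
  have cF : τ * (-Real.log γ) + (1 - 2 * τ) * (-Real.log a) + τ * (-Real.log α) ≤ H := by
    linarith [cD]
  -- the barrier
  have key := omegaHat_bigCw_ge_of_costs (K := K) q (theta_mem_stdSimplex hτ0 hτ1)
    (α₁ := α) (β₁ := β) (γ₁ := γ) (α₂ := a) (β₂ := b) (γ₂ := b) (α₃ := α) (β₃ := β) (γ₃ := γ)
    (h := H / Real.log 2)
    hα0 hβ0 hγ0 ha0 hb0 hb0 hα0 hβ0 hγ0 hmass₁ hmass₂ hmass₁ hh0 hhL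
    (by rw [theta_zero, theta_one, theta_two]; exact cost_div_log_two cA)
    (by rw [theta_zero, theta_one, theta_two]; exact cost_div_log_two cB)
    (by rw [theta_zero, theta_one, theta_two]; exact cost_div_log_two cC)
    (by rw [theta_zero, theta_one, theta_two]; exact cost_div_log_two cD)
    (by rw [theta_zero, theta_one, theta_two]; exact cost_div_log_two cE)
    (by rw [theta_zero, theta_one, theta_two]; exact cost_div_log_two cF)
    hω
  rw [theta_one, hmid] at key
  -- `log₂(q+2) / (H / log 2) = L / H`
  have e1 : Real.logb 2 ((q : ℝ) + 2) / (H / Real.log 2) = L / H := by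
    rw [Real.logb, hLdef]; field_simp
  rw [e1] at key
  have hfin : p + 1 < L / H * ((1 + σ) + p * (1 - σ)) := by
    rw [div_mul_eq_mul_div, lt_div_iff₀ hH0, hHdef]
    exact arith_final hσ0 hL0 hρL
  exact lt_of_lt_of_le hfin key

/-- **At every grade the `CW_q`-method floor is positive**: for natural `k ≥ 1` and every `q`, every
`CW_q`-method bound `ω̂` on `ω(k)` satisfies `k + 1 < ω̂` — the equality `ω(1,k,1) = k + 1` (the onset
hypothesis of `TailDescentTwo`, `FiniteSaturation`) is certified by no `CW_q`-method.
[cite: ChristandlLeGallLysikovZuiddam2025, Thm. 3.15 with eq. (5)] -/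
theorem nat_add_one_lt_of_tMethodBound_bigCw (K : Type) [Field K] (q k : ℕ) (hk : 1 ≤ k) {ω : ℝ}
    (hω : IsTMethodBound K (bigCwTensor K q) k ω) : (k : ℝ) + 1 < ω :=
  add_one_lt_of_tMethodBound_bigCw K q (by exact_mod_cast hk) hω

/-- **A zero of the defect lies strictly below every `CW_q`-method bound**: if `ω(1,k,1) = k + 1`
for some real `k ≥ 1` (the onset hypothesis of `TailDescentTwo` at `k ≥ 3`, or its conclusion at `k = 2`),
then every `CW_q`-method bound `ω̂` on `ω(k)` satisfies `ω(1,k,1) < ω̂` — the equality is certified by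
no `CW_q`-method, for any `q`. [cite: ChristandlLeGallLysikovZuiddam2025, Thm. 3.15 with eq. (5)] -/
theorem omegaRect_lt_tMethodBound_of_eq_add_one (K : Type) [Field K] (q : ℕ) {k : ℝ} (hk : 1 ≤ k)
    (heq : omegaRect ℂ 1 k 1 = k + 1) {ω : ℝ} (hω : IsTMethodBound K (bigCwTensor K q) k ω) :
    omegaRect ℂ 1 k 1 < ω := by
  rw [heq]; exact add_one_lt_of_tMethodBound_bigCw K q hk hω

end Summit.MatrixMultiplication.MatrixMultiplication.Theorems.SaturationLadderDefectFloorUniform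

end
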